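import Summits.ResolutionOfSingularities.ResolutionOfSingularities.Statement
import Literature.RingTheory.TightClosure.RegularTightlyClosed
import Mathlib.Algebra.CharP.Algebra
import HarnessLib

/-!
# The inserted rungs are summit-implied — crux `FrobeniusLadder.FRationalResolution` (line `Sketch`)

Stub `stub_rungsOfSummit` of the skeleton `Sketch` for crux stmt-ResolutionOfSingularities-15317, the
route's KILL-CRITERION sanity check for the two inserted rungs (`WeaklyFRegularModification`,
`WeaklyFRegularResolution`): under the summit `ResolutionOfSingularities`, every reduced separated
finite-type `X/k` over a field `k` of prime characteristic `p` has a weakly F-regular locally-integral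
proper birational model — namely a resolution `π : X̃ → X` (`X̃` regular). Every stalk `𝒪_{X̃,x}` is a
regular local ring, hence a domain (Matsumura Thm. 14.3,
`Literature.AlgebraicGeometry.Resolution.isDomain_of_isRegularLocalRing`), of characteristic `p`
(through the ring map `k → Γ(Spec k, 𝒪) → Γ(X̃, 𝒪) → 𝒪_{X̃,x}` along `X̃ → X → Spec k`), in which
every ideal is tightly closed (Hochster–Huneke Thm. 4.4 via Kunz,
`Literature.RingTheory.TightClosure.isTightlyClosed_of_isRegularLocalRing`), unfolded to the route's
inline clause by `Literature.RingTheory.TightClosure.isTightlyClosed_iff_of_isDomain`.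
-/

set_option linter.dupNamespace false

noncomputable section

open CategoryTheory AlgebraicGeometry TopologicalSpace Literature.AlgebraicGeometry.Resolution
  Literature.RingTheory.TightClosure

namespace Summit.ResolutionOfSingularities.ResolutionOfSingularities.Theorems.FRationalResolution.RungsOfSummit

/-- The nontrivial stalks of a scheme `Y` over a field `k` of characteristic `p ≠ 0` have
characteristic `p`: `k → Γ(Spec k, 𝒪) → Γ(Y, 𝒪_Y) → 𝒪_{Y,y}` is a ring map out of a field
(`CharP.of_ringHom_of_ne_zero`). [folklore] -/
theorem charP_stalk_of_over {p : ℕ} (hp : p ≠ 0) (k : Type) [Field k] [CharP k p]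
    {Y : Scheme.{0}} (g : Y ⟶ Spec (.of k)) (y : Y) [Nontrivial (Y.presheaf.stalk y)] :
    CharP (Y.presheaf.stalk y) p :=
  CharP.of_ringHom_of_ne_zero
    ((Y.presheaf.germ ⊤ y trivial).hom.comp
      (g.appTop.hom.comp (Scheme.ΓSpecIso (.of k)).inv.hom)) p hp

/-- SANITY (route KILL CRITERIA): under the summit, every reduced separated finite-type `X/k`
(char `p` prime) has a weakly F-regular locally-integral proper birational model — namely a
resolution `X̃ → X`: a regular local ring is a domain (`isDomain_of_isRegularLocalRing`) in which
every ideal is tightly closed (`isTightlyClosed_of_isRegularLocalRing`, unfolded by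
`isTightlyClosed_iff_of_isDomain`; the stalks of `X̃` have characteristic `p` through
`X̃ → X → Spec k`). Hence both inserted rungs of line `Sketch` are consequences of the summit. -/
theorem stub_rungsOfSummit (hsummit : _root_.ResolutionOfSingularities) (p : ℕ) (hp : p.Prime)
    (k : Type) [Field k] [CharP k p] (X : Scheme.{0}) (f : X ⟶ Spec (.of k)) [IsSeparated f]
    [LocallyOfFiniteType f] [QuasiCompact f] [IsReduced X] :
    ∃ (X' : Scheme.{0}) (π : X' ⟶ X), IsProper π ∧ IsBirational π ∧
      ∀ x : X', IsDomain (X'.presheaf.stalk x) ∧ ∀ I : Ideal (X'.presheaf.stalk x),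
        ∀ y c : X'.presheaf.stalk x, c ≠ 0 →
        (∀ e : ℕ, c * y ^ p ^ e ∈ Ideal.span ((fun z : X'.presheaf.stalk x => z ^ p ^ e) ''
          (I : Set (X'.presheaf.stalk x)))) → y ∈ I := by
  obtain ⟨X', π, hres⟩ := hsummit p hp k X f ‹_› ‹_› ‹_› ‹_›
  refine ⟨X', π, hres.isProper, hres.isBirational, fun x => ?_⟩
  haveI : Fact p.Prime := ⟨hp⟩
  haveI : IsRegularLocalRing (X'.presheaf.stalk x) := hres.isRegular x
  haveI : IsDomain (X'.presheaf.stalk x) := isDomain_of_isRegularLocalRing _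
  haveI : CharP (X'.presheaf.stalk x) p := charP_stalk_of_over hp.ne_zero k (π ≫ f) x
  exact ⟨inferInstance, fun I =>
    (isTightlyClosed_iff_of_isDomain p).mp (isTightlyClosed_of_isRegularLocalRing p I)⟩

end Summit.ResolutionOfSingularities.ResolutionOfSingularities.Theorems.FRationalResolution.RungsOfSummit

end
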